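import Summits.AtomisticToContinuum.Crystallization.Theorems.OverbindingBudgetAffineCompressedCutKernel

/-!
# Overbinding budget — compressed cut: kernel tables II (two-parent stacking `UP2`, fcc parent layers)

Kernel-computed tables (`decide +kernel`) for the exact adjacency kernel (read through `kernelTwoB_sound`):
a child in the cap ABOVE (`s = 1`) or BELOW (`s = -1`) a layer whose sites carry the aligned fcc copy `F⁺`
(resp. `F⁻`), registered against TWO adjacent parents of that layer (at `0` and at `x − x₂`), has a UNIQUE
aligned pull-back: the fcc copy of the parent layer's orientation class or the complementary hcp copy —

| parent | side | fcc child | hcp child |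
|---|---|---|---|
| `F⁺` | above | `F⁺` | `H′` |
| `F⁺` | below | `F⁺` | `H` |
| `F⁻` | above | `F⁻` | `H` |
| `F⁻` | below | `F⁻` | `H′` |

(one parent alone leaves a twin ambiguity for hcp children — `numerics/kernels.out`).  The hcp parent layers are
in `…KernelStackH`.  No `sorry`, no new axioms.
-/

namespace Summit.AtomisticToContinuum.Crystallization.Theorems.OverbindingBudgetAffineCompressedCutKernel

/-- UP2: parent layer `F⁺`, child above, fcc ⇒ `F⁺`. [this file, by `decide +kernel`] -/
theorem up_fcc_pos_fcc : kernelTwoB fccL 1 fccL [fccL] = true := by decide +kernel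
/-- UP2: parent layer `F⁺`, child above, hcp ⇒ `H′`. [this file, by `decide +kernel`] -/
theorem up_fcc_pos_hcp : kernelTwoB fccL 1 hcpL [hcpAltL] = true := by decide +kernel
/-- UP2: parent layer `F⁺`, child below, fcc ⇒ `F⁺`. [this file, by `decide +kernel`] -/
theorem up_fcc_neg_fcc : kernelTwoB fccL (-1) fccL [fccL] = true := by decide +kernel
/-- UP2: parent layer `F⁺`, child below, hcp ⇒ `H`. [this file, by `decide +kernel`] -/
theorem up_fcc_neg_hcp : kernelTwoB fccL (-1) hcpL [hcpL] = true := by decide +kernel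
/-- UP2: parent layer `F⁻`, child above, fcc ⇒ `F⁻`. [this file, by `decide +kernel`] -/
theorem up_fccNeg_pos_fcc : kernelTwoB fccNegL 1 fccL [fccNegL] = true := by decide +kernel
/-- UP2: parent layer `F⁻`, child above, hcp ⇒ `H`. [this file, by `decide +kernel`] -/
theorem up_fccNeg_pos_hcp : kernelTwoB fccNegL 1 hcpL [hcpL] = true := by decide +kernel
/-- UP2: parent layer `F⁻`, child below, fcc ⇒ `F⁻`. [this file, by `decide +kernel`] -/
theorem up_fccNeg_neg_fcc : kernelTwoB fccNegL (-1) fccL [fccNegL] = true := by decide +kernel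
/-- UP2: parent layer `F⁻`, child below, hcp ⇒ `H′`. [this file, by `decide +kernel`] -/
theorem up_fccNeg_neg_hcp : kernelTwoB fccNegL (-1) hcpL [hcpAltL] = true := by decide +kernel

end Summit.AtomisticToContinuum.Crystallization.Theorems.OverbindingBudgetAffineCompressedCutKernel
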